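import Mathlib
import Summits.MatrixMultiplication.Statement
import Summits.MatrixMultiplication.MatrixMultiplication.Theorems.GraphEquationsHasseSchmidt
import Summits.MatrixMultiplication.MatrixMultiplication.Theorems.GraphEquationsCoeffIdentity

/-!
# Graph equations — THE TIGHT HAND: a rank-free exact form of the crux (M21c, decomp-mm-lens-5 g34)

(supports `MultiplicityReduction`, stmt-MatrixMultiplication-27806; packages `GraphEquationsHasseSchmidt`
(M21a).  No new definition.)

M21a proved EVERY rung of the TIGHT membership ladder at quadratic cost: a correct system of format `n`
whose tests lie in `I^{k+1}` and whose test ideal contains `f_q^{k+2}` yields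
`R(⟨n,n,n⟩) ≤ 6·C(k+2,2)·cost`.  Consequently the finite range of the dial DISAPPEARS on tight systems, and
what is left of `MultiplicityReduction` is a statement about equation systems alone, with no rank in it:

  TIGHT HAND (TH):  for `β ≥ 2`, `EqAdmissible β ⇒ ∀ β' > β ∃ c ∀ n ≥ 1 ∃ E k`, `E` correct of format `n`,
                    tests in `I^{k+1}`, `f_q^{k+2} ∈ J_E (∀ q)`, and `C(k+2,2)·cost E ≤ c·n^{β'}`
  (the membership exponent `k+2` may grow with `n` — polynomially, `C(k+2,2) ≤ n^{β'-β}` is affordable).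

* `exists_tightFamily_of_omega_lt` / `tightHand_of_matrixMultiplication` — **NEC** (`ω < β ⇒` reduced, hence
  tight with `k = 0`, families of cost `O(n^β)`: [BCS97, Prop. 15.1]).
* `multiplicityReduction_of_tightHand` — **TH ⇒ MultiplicityReduction** (M21a's bridge, by name).
* `matrixMultiplication_iff_quadratic_tightHand` — **EXACT**: `ω = 2 ⟺ V ∧ TH`;
  `multiplicityReduction_iff_tightHand_of_quadratic` — given `V`, `MultiplicityReduction ⟺ TH`.
* `omega_le_iff_tightFamilies` — a RANK-FREE CHARACTERISATION OF THE EXPONENT: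
  `ω ≤ β ⟺ ∀ β' > β`, polynomially-tight correct graph-equation families of cost `O(n^{β'})` exist.

Lens 5 reading: the crux now has two exact cuts with the finite range fully discharged on one of them —
(ε-dial, M21b) `MR ⟺ NER ∧ (∀ e ≥ 3, RUNG^ε(e))` given `V`, finite range open from `e = 3`;
(tight dial, here) `MR ⟺ TH` given `V`, finite range EMPTY, the whole difficulty moved into the hand
«purify a cheap correct family to a cheap TIGHT one».
-/

set_option linter.dupNamespace false

noncomputable section

open scoped BigOperators

namespace Summit.MatrixMultiplication.MatrixMultiplication.Theorems.GraphEquations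

open MvPolynomial
open Literature.Computability.AlgebraicComplexity
open Literature.Computability.AlgebraicComplexity.ArithCircuit

variable {n : ℕ}

/-! ## Tight families are necessary -/

/-- **NEC (absolute form).**  Above `ω` there are polynomially-tight correct families: indeed REDUCED ones
(`f_q ∈ J_E`, tests in `I = I^{0+1}`, `k = 0`, `C(2,2) = 1`). -/
theorem exists_tightFamily_of_omega_lt {β : ℝ} (hβ : omega ℂ < β) :
    ∃ c : ℝ, ∀ n : ℕ, 1 ≤ n → ∃ (E : EqSystem n) (k : ℕ), E.Correct ∧
      (∀ j ∈ E.tests, E.testPoly j ∈ graphIdeal n ^ (k + 1)) ∧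
      (∀ q : Fin n × Fin n, generator n q ^ (k + 2) ∈
        Ideal.span (Set.range fun o : Fin E.tests.length => E.testPoly (E.tests.get o))) ∧
      ((k + 2).choose 2 : ℝ) * (E.cost : ℝ) ≤ c * (n : ℝ) ^ β := by
  obtain ⟨c, hc⟩ := exists_correct_generator_mem_of_omega_lt hβ
  refine ⟨c, fun n hn => ?_⟩
  obtain ⟨E, hE, hmem, hcost⟩ := hc n hn
  refine ⟨E, 0, hE, fun j hj => ?_, fun q => ?_, ?_⟩
  · simpa only [zero_add, pow_one] using hE.testPoly_mem_graphIdeal' hj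
  · have h1 := hmem q
    rw [pow_one] at h1
    simpa only [zero_add] using Ideal.pow_mem_of_mem _ h1 2 (by norm_num)
  · simpa [Nat.choose] using hcost

/-- **NEC.**  `ω = 2 ⇒ TH`. -/
theorem tightHand_of_matrixMultiplication (hS : _root_.MatrixMultiplication) :
    ∀ β : ℝ, 2 ≤ β → EqAdmissible β → ∀ β' : ℝ, β < β' →
      ∃ c : ℝ, ∀ n : ℕ, 1 ≤ n → ∃ (E : EqSystem n) (k : ℕ), E.Correct ∧
        (∀ j ∈ E.tests, E.testPoly j ∈ graphIdeal n ^ (k + 1)) ∧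
        (∀ q : Fin n × Fin n, generator n q ^ (k + 2) ∈
          Ideal.span (Set.range fun o : Fin E.tests.length => E.testPoly (E.tests.get o))) ∧
        ((k + 2).choose 2 : ℝ) * (E.cost : ℝ) ≤ c * (n : ℝ) ^ β' := by
  intro β hβ _ β' hβ'
  have h2 : omega ℂ = 2 := hS
  exact exists_tightFamily_of_omega_lt (by rw [h2]; linarith)

/-! ## The tight hand decides the crux -/

/-- **TH ⇒ MultiplicityReduction** (the tight dial of M21a: every rung proved, so the hand alone suffices). -/
theorem multiplicityReduction_of_tightHand
    (h : ∀ β : ℝ, 2 ≤ β → EqAdmissible β → ∀ β' : ℝ, β < β' →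
      ∃ c : ℝ, ∀ n : ℕ, 1 ≤ n → ∃ (E : EqSystem n) (k : ℕ), E.Correct ∧
        (∀ j ∈ E.tests, E.testPoly j ∈ graphIdeal n ^ (k + 1)) ∧
        (∀ q : Fin n × Fin n, generator n q ^ (k + 2) ∈
          Ideal.span (Set.range fun o : Fin E.tests.length => E.testPoly (E.tests.get o))) ∧
        ((k + 2).choose 2 : ℝ) * (E.cost : ℝ) ≤ c * (n : ℝ) ^ β') :
    MultiplicityReduction := by
  intro β hβ hA β' hβ'
  obtain ⟨c, hc⟩ := h β hβ hA ((β + β') / 2) (by linarith)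
  exact eqAdmissibleRed_of_tight_polyGrowth ⟨c, hc⟩ β' (by linarith)

/-- **EXACT**: `ω = 2 ⟺ V ∧ TH` — the residual `V` and a RANK-FREE hand; no finite range remains. -/
theorem matrixMultiplication_iff_quadratic_tightHand :
    _root_.MatrixMultiplication ↔
      GraphEquationsQuadratic ∧
      (∀ β : ℝ, 2 ≤ β → EqAdmissible β → ∀ β' : ℝ, β < β' →
        ∃ c : ℝ, ∀ n : ℕ, 1 ≤ n → ∃ (E : EqSystem n) (k : ℕ), E.Correct ∧
          (∀ j ∈ E.tests, E.testPoly j ∈ graphIdeal n ^ (k + 1)) ∧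
          (∀ q : Fin n × Fin n, generator n q ^ (k + 2) ∈
            Ideal.span (Set.range fun o : Fin E.tests.length => E.testPoly (E.tests.get o))) ∧
          ((k + 2).choose 2 : ℝ) * (E.cost : ℝ) ≤ c * (n : ℝ) ^ β') := by
  constructor
  · intro hS
    exact ⟨nec_quadratic hS, tightHand_of_matrixMultiplication hS⟩
  · rintro ⟨hV, hTH⟩
    exact matrixMultiplication_of_quadratic_of_multiplicityReduction hV
      (multiplicityReduction_of_tightHand hTH)

/-- **The crux, given the residual**: under `V`, `MultiplicityReduction ⟺ TH`. -/
theorem multiplicityReduction_iff_tightHand_of_quadratic (hV : GraphEquationsQuadratic) :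
    MultiplicityReduction ↔
      (∀ β : ℝ, 2 ≤ β → EqAdmissible β → ∀ β' : ℝ, β < β' →
        ∃ c : ℝ, ∀ n : ℕ, 1 ≤ n → ∃ (E : EqSystem n) (k : ℕ), E.Correct ∧
          (∀ j ∈ E.tests, E.testPoly j ∈ graphIdeal n ^ (k + 1)) ∧
          (∀ q : Fin n × Fin n, generator n q ^ (k + 2) ∈
            Ideal.span (Set.range fun o : Fin E.tests.length => E.testPoly (E.tests.get o))) ∧
          ((k + 2).choose 2 : ℝ) * (E.cost : ℝ) ≤ c * (n : ℝ) ^ β') := by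
  constructor
  · intro hM
    exact tightHand_of_matrixMultiplication (matrixMultiplication_of_quadratic_of_multiplicityReduction hV hM)
  · exact multiplicityReduction_of_tightHand

/-! ## A rank-free characterisation of the exponent -/

/-- **`ω ≤ β ⟺` polynomially-tight correct families exist at every cost exponent above `β`.**
(`⇐`: the tight dial `omega_le_of_tight_polyGrowth`; `⇒`: reduced families above `ω`.) -/
theorem omega_le_iff_tightFamilies (β : ℝ) :
    omega ℂ ≤ β ↔ ∀ β' : ℝ, β < β' →
      ∃ c : ℝ, ∀ n : ℕ, 1 ≤ n → ∃ (E : EqSystem n) (k : ℕ), E.Correct ∧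
        (∀ j ∈ E.tests, E.testPoly j ∈ graphIdeal n ^ (k + 1)) ∧
        (∀ q : Fin n × Fin n, generator n q ^ (k + 2) ∈
          Ideal.span (Set.range fun o : Fin E.tests.length => E.testPoly (E.tests.get o))) ∧
        ((k + 2).choose 2 : ℝ) * (E.cost : ℝ) ≤ c * (n : ℝ) ^ β' := by
  constructor
  · intro hω β' hβ'
    exact exists_tightFamily_of_omega_lt (hω.trans_lt hβ')
  · intro h
    refine le_of_forall_gt_imp_ge_of_dense fun β'' hβ'' => ?_
    have h1 := omega_le_of_tight_polyGrowth (h ((β + β'') / 2) (by linarith))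
    linarith

end Summit.MatrixMultiplication.MatrixMultiplication.Theorems.GraphEquations

end
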